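import Literature.AlgebraicGeometry.Resolution.BlowupAlgebraPresentation
import Literature.AlgebraicGeometry.Resolution.BlowupAlgebraStrictTransform
import Literature.AlgebraicGeometry.Resolution.BlowupAlgebraDerivations
import Literature.AlgebraicGeometry.Resolution.RegularDerivationQuotient
import Literature.AlgebraicGeometry.Resolution.RegularHomReduced
import Literature.AlgebraicGeometry.Resolution.MvPolynomialKillVars
import Literature.AlgebraicGeometry.Resolution.QuasiRegularSequences
import Mathlib.RingTheory.RegularLocalRing.Polynomial
import Mathlib.Algebra.MvPolynomial.PDeriv
import HarnessLib

/-!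
# [OURS · L1 W4.5(b)] EL♮ specimen R2 — the WHITNEY-TYPE CUBIC `x₁x₂² = x₀x₃²`: chart algebra of the blow-up along its double line
# crux `Theses.EquisingularLift.EquisingularLiftNat` (stmt-ResolutionOfSingularities-20038), res-L1-w45b-plan-1 ORDERS (R2)

NOT a statement of any manuscript; OURS kernel specimen (cell `res-hironaka`, chain w45b, seat res-D-pv-022). AI-written,
weaker than expert review.

The specimen surface is `H = V(x₁x₂² − x₀x₃²) ⊂ ℙ³_k` (the ordered `V(x₀²x₃ − x₁²x₂)` after the coordinate renaming
`(0 2)(1 3)`), an integral cubic whose singular locus is the DOUBLE LINE `Σ = V(x₂, x₃)` in every characteristic (the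
tangent cone along `Σ` is the moving double plane; two pinch points for `p ≠ 2`, an inseparable double line for `p = 2`).
This file is the COMMUTATIVE ALGEBRA of «`Bl_Σ H` is regular», over an ARBITRARY field `k`: on the affine chart
`D₊(x_c)` with coordinates `y = (y₀, y₁, y₂)` (`x_c := 1`, the other variables in order) the surface is `V(f_c)`,

  `f₀ = y₀y₁² − y₂²`, `f₁ = y₁² − y₀y₂²` (centre `(y₁, y₂)`),   `f₂ = y₁ − y₀y₂²`, `f₃ = y₁y₂² − y₀` (centre `= (1)`),

and the chart rings of the blow-up of `V(f_c)` (`c = 0, 1`) along `(ȳ₁, ȳ₂)` are, by the tree's strict-transform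
presentation `(A/(f))[Ī/b̄] ≅ A[I/b]/(f′)` (`blowupAlgebra.quotientKerMapQuotientEquiv`, Görtz–Wedhorn Prop. 13.96 (2)),
the quotients of the regular rings `A[I/b]` (`blowupAlgebra.isRegularRing`, Liu Thm 8.1.19 (a)) by the strict transforms

  `f₀ = y₁²·(y₀ − t²)`, `f₀ = y₂²·(y₀s² − 1)`, `f₁ = y₁²·(1 − y₀t²)`, `f₁ = y₂²·(s² − y₀)`  (`t = y₂/y₁`, `s = y₁/y₂`),

each killed to a UNIT by the plain extension of `∂/∂y₀` (Stacks 07PF, `isRegularRing_quotient_of_derivation`); the two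
charts with trivial centre are the regular rings `A/(f₂)`, `A/(f₃)` (`∂/∂y₁`, `∂/∂y₀`). Everything is PROVED; the only
definition is the centre sequence `cen = (y₁, y₂)`.

* `cen`, `isQuasiRegular_cen`, `isRegularRing_quotient_cen`, `isDomain_quotient_cen`, `isRegularRing_chart`,
  `prime_algebraMap_cen` — the centre `(y₁, y₂) ⊂ k[y₀,y₁,y₂]` and the regular chart rings `A[I/y₁]`, `A[I/y₂]`;
* `isRegularRing_blowupAlgebra_quotient` — GENERIC: `f = bⁿ·f′` in `A[I/b]` with `f′ = G(y_j/b)`, a coefficient of `G`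
  outside `I`, and `D(f′)` a unit modulo `f′` for the plain extension `D` of `∂/∂y₀` ⟹ `(A/(f))[Ī/b̄]` is a regular ring;
* `isRegularRing_chart₀₁`, `…₀₂`, `…₁₁`, `…₁₂` — the four strict-transform charts; `isRegularRing_quotient_f₂`, `…_f₃`,
  `isReduced_quotient_f₂`, `…_f₃` — the two charts off `Σ`.

References: Görtz–Wedhorn I (13.19), Prop. 13.96; Liu 2002 Thm 8.1.19; Stacks 07PF, 0BIQ — through the cited tree files.
-/

set_option linter.dupNamespace false -- mandated namespace `Summit.<Summit>.<Problem>` of this single-conjunct summit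

noncomputable section

open MvPolynomial
open Literature.AlgebraicGeometry.Resolution

namespace Summit.ResolutionOfSingularities.ResolutionOfSingularities.Cruxes.EquisingularLiftNat.Sections

namespace WhitneyCubic

variable (k : Type) [Field k]

/-! ## The centre `(y₁, y₂) ⊂ A = k[y₀, y₁, y₂]` -/

/-- The centre sequence `(y₁, y₂)` of the chart ring `A = k[y₀, y₁, y₂]` (the double line `Σ ∩ D₊(x_c)`, `c = 0, 1`).
[folklore] -/
def cen : Fin 2 → MvPolynomial (Fin 3) k := ![X 1, X 2]

/-- `cen 0 = y₁`. [folklore] -/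
@[simp] theorem cen_zero : cen k 0 = X 1 := rfl

/-- `cen 1 = y₂`. [folklore] -/
@[simp] theorem cen_one : cen k 1 = X 2 := rfl

/-- The centre generators are the variables `y₁, y₂`. [folklore] -/
theorem range_cen : Set.range (cen k) = X '' ({1, 2} : Set (Fin 3)) := by
  ext p
  constructor
  · rintro ⟨i, rfl⟩
    fin_cases i
    · exact ⟨1, by simp, rfl⟩
    · exact ⟨2, by simp, rfl⟩
  · rintro ⟨j, hj, rfl⟩
    simp only [Set.mem_insert_iff, Set.mem_singleton_iff] at hj
    rcases hj with rfl | rfl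
    · exact ⟨0, rfl⟩
    · exact ⟨1, rfl⟩

/-- `I = (y₁, y₂)` as the span of a set of variables. [folklore] -/
theorem span_range_cen :
    Ideal.span (Set.range (cen k)) = Ideal.span (X '' ({1, 2} : Set (Fin 3)) : Set (MvPolynomial (Fin 3) k)) := by
  rw [range_cen]

/-- `(y₁, y₂)` is a quasi-regular sequence (distinct variables are weakly regular, Rees' theorem). [folklore] -/
theorem isQuasiRegular_cen : IsQuasiRegular (cen k) := by
  apply isQuasiRegular_of_isWeaklyRegular
  have h := MvPolynomial.isWeaklyRegular_map_X (R := k) ([1, 2] : List (Fin 3)) (by decide)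
  have hl : List.ofFn (cen k) = ([1, 2] : List (Fin 3)).map (X : Fin 3 → MvPolynomial (Fin 3) k) := by
    simp [List.ofFn_succ]
  rw [hl]
  exact h

/-- `A/(y₁, y₂) ≅ k[y₀]` is a domain. [folklore] -/
theorem isDomain_quotient_cen : IsDomain (MvPolynomial (Fin 3) k ⧸ Ideal.span (Set.range (cen k))) := by
  rw [span_range_cen]
  exact MvPolynomial.isDomain_quotient_span_X _

/-- `A/(y₁, y₂) ≅ k[y₀]` is a regular ring. [folklore] -/
theorem isRegularRing_quotient_cen : IsRegularRing (MvPolynomial (Fin 3) k ⧸ Ideal.span (Set.range (cen k))) := by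
  rw [span_range_cen]
  exact IsRegularRing.of_ringEquiv (MvPolynomial.quotientSpanXEquiv (R := k) ({1, 2} : Set (Fin 3))).toRingEquiv.symm

/-- `(y₁, y₂)` is a proper ideal. [folklore] -/
theorem span_range_cen_ne_top : Ideal.span (Set.range (cen k)) ≠ ⊤ := by
  haveI := isDomain_quotient_cen k
  exact ((Ideal.Quotient.isDomain_iff_prime _).mp inferInstance).ne_top

/-- `y₀ ∉ (y₁, y₂)`. [folklore] -/
theorem X_zero_not_mem : (X 0 : MvPolynomial (Fin 3) k) ∉ Ideal.span (Set.range (cen k)) := by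
  rw [span_range_cen]
  exact MvPolynomial.X_not_mem_span_X _ (by simp)

/-- `1 ∉ (y₁, y₂)`. [folklore] -/
theorem one_not_mem : (1 : MvPolynomial (Fin 3) k) ∉ Ideal.span (Set.range (cen k)) := fun h =>
  span_range_cen_ne_top k ((Ideal.eq_top_iff_one _).mpr h)

/-- `∂/∂y₀` kills the centre generators. [folklore] -/
theorem pderiv_zero_cen (j : Fin 2) :
    (pderiv 0 : Derivation k (MvPolynomial (Fin 3) k) (MvPolynomial (Fin 3) k)) (cen k j) = 0 := by
  fin_cases j <;> simp [pderiv_X]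

/-- `∂/∂y₀` preserves the centre ideal. [folklore] -/
theorem pderiv_zero_mem {y : MvPolynomial (Fin 3) k} (hy : y ∈ Ideal.span (Set.range (cen k))) :
    (pderiv 0 : Derivation k (MvPolynomial (Fin 3) k) (MvPolynomial (Fin 3) k)) y ∈ Ideal.span (Set.range (cen k)) :=
  blowupAlgebra.apply_mem_span_of_forall_apply_eq_zero (cen k) k (pderiv 0) (pderiv_zero_cen k) hy

/-! ## The chart rings `A[I/y₁]`, `A[I/y₂]` -/

/-- `A[1/b]` is a domain for `b` a centre generator. [folklore] -/
theorem isDomain_away_cen (i : Fin 2) : IsDomain (Localization.Away (cen k i)) :=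
  IsLocalization.isDomain_of_le_nonZeroDivisors (M := Submonoid.powers (cen k i)) _
    (powers_le_nonZeroDivisors_of_noZeroDivisors (by fin_cases i <;> exact X_ne_zero _))

/-- `A[I/b]` is a domain. [folklore] -/
theorem isDomain_chart (i : Fin 2) : IsDomain (blowupAlgebra (Ideal.span (Set.range (cen k))) (cen k i)) :=
  haveI := isDomain_away_cen k i
  inferInstance

/-- **`A[I/b]` is a regular ring** (`b = y₁, y₂`; Liu Thm 8.1.19 (a) on the charts). [folklore] -/
theorem isRegularRing_chart (i : Fin 2) : IsRegularRing (blowupAlgebra (Ideal.span (Set.range (cen k))) (cen k i)) := by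
  haveI := isRegularRing_quotient_cen k
  exact blowupAlgebra.isRegularRing (cen k) i (isQuasiRegular_cen k)

/-- **`b` is a prime element of `A[I/b]`** (`A[I/b]/(b) ≅ (A/I)[T]`, Stacks 0BIQ). [folklore] -/
theorem prime_algebraMap_cen (i : Fin 2) :
    Prime (algebraMap (MvPolynomial (Fin 3) k) (blowupAlgebra (Ideal.span (Set.range (cen k))) (cen k i)) (cen k i)) := by
  haveI := isDomain_quotient_cen k
  haveI := isDomain_chart k i
  have hP := blowupAlgebra.isPrime_span_algebraMap (cen k) i (isQuasiRegular_cen k)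
  have hne : algebraMap (MvPolynomial (Fin 3) k) (blowupAlgebra (Ideal.span (Set.range (cen k))) (cen k i)) (cen k i) ≠ 0 :=
    nonZeroDivisors.ne_zero
      (algebraMap_mem_nonZeroDivisors_blowupAlgebra (I := Ideal.span (Set.range (cen k))) (a := cen k i))
  exact (Ideal.span_singleton_prime hne).mp hP


/-- In a commutative monoid `a * b = 1` makes `a` a unit (stated to avoid the Dedekind-finiteness instance search on the
chart quotients). [folklore] -/
theorem isUnit_of_mul_eq_one' {M : Type*} [CommMonoid M] {a : M} (b : M) (h : a * b = 1) : IsUnit a :=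
  ⟨⟨a, b, h, by rw [mul_comm]; exact h⟩, rfl⟩

/-! ## The generic strict-transform chart -/

/-- **GENERIC STRICT-TRANSFORM CHART.** Let `b = cen i`, `B = A[I/b]`, `G ∈ A[T]` a chart polynomial with value
`f′ = G(y_j/b) ∈ B` and `f = bⁿ · f′` in `B`. If some coefficient of `G` lies outside `I = (y₁, y₂)` (so `b ∤ f′`, Stacks
0BIQ) and the plain extension `D` of `∂/∂y₀` to `B` (it kills the `y_j/b`) takes `f′` to a unit modulo `f′` (Stacks 07PF),
then the chart ring `(A/(f))[Ī/b̄] ≅ B/(f′)` of the blow-up of `V(f)` along `(ȳ₁, ȳ₂)` is a regular ring.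
[folklore; GW Prop. 13.96 (2), Stacks 07PF] -/
theorem isRegularRing_blowupAlgebra_quotient (i : Fin 2) {f : MvPolynomial (Fin 3) k} {n : ℕ}
    (G : MvPolynomial {j : Fin 2 // j ≠ i} (MvPolynomial (Fin 3) k))
    (hf : algebraMap (MvPolynomial (Fin 3) k) (blowupAlgebra (Ideal.span (Set.range (cen k))) (cen k i)) f =
      algebraMap (MvPolynomial (Fin 3) k) (blowupAlgebra (Ideal.span (Set.range (cen k))) (cen k i)) (cen k i) ^ n *
        blowupAlgebra.eval (cen k) i G)
    {m : {j : Fin 2 // j ≠ i} →₀ ℕ} (hm : G.coeff m ∉ Ideal.span (Set.range (cen k)))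
    (hunit : ∀ D : Derivation k (blowupAlgebra (Ideal.span (Set.range (cen k))) (cen k i))
        (blowupAlgebra (Ideal.span (Set.range (cen k))) (cen k i)),
      (∀ r, D (algebraMap _ _ r) =
        algebraMap _ _ ((pderiv 0 : Derivation k (MvPolynomial (Fin 3) k) (MvPolynomial (Fin 3) k)) r)) →
      (∀ j, D (blowupAlgebra.frac (cen k) i j) = 0) →
      IsUnit (Ideal.Quotient.mk (Ideal.span {blowupAlgebra.eval (cen k) i G}) (D (blowupAlgebra.eval (cen k) i G)))) :
    IsRegularRing (blowupAlgebra ((Ideal.span (Set.range (cen k))).map (Ideal.Quotient.mk (Ideal.span {f})))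
      (Ideal.Quotient.mk (Ideal.span {f}) (cen k i))) := by
  haveI := isRegularRing_chart k i
  obtain ⟨D, hD, hDgen⟩ := exists_derivation_blowupAlgebra_of_apply_eq_zero (I := Ideal.span (Set.range (cen k)))
    (a := cen k i) k (pderiv 0) (pderiv_zero_cen k i) (fun y hy => pderiv_zero_mem k hy)
  have hfrac : ∀ j, D (blowupAlgebra.frac (cen k) i j) = 0 := fun j =>
    blowupAlgebra.derivation_frac_eq_zero_of_apply_eq_zero (cen k) i k D (pderiv 0)
      (fun y hy => pderiv_zero_mem k hy) hDgen j (pderiv_zero_cen k j)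
  haveI hreg : IsRegularRing (blowupAlgebra (Ideal.span (Set.range (cen k))) (cen k i) ⧸
      Ideal.span {blowupAlgebra.eval (cen k) i G}) :=
    isRegularRing_quotient_of_derivation _ D (hunit D hD hfrac)
  have hndvd : ¬ algebraMap _ (blowupAlgebra (Ideal.span (Set.range (cen k))) (cen k i)) (cen k i) ∣
      blowupAlgebra.eval (cen k) i G := fun h =>
    hm ((blowupAlgebra.eval_mem_span_algebraMap_iff (cen k) i (isQuasiRegular_cen k) G).mp
      (Ideal.mem_span_singleton.mpr h) m)
  exact IsRegularRing.of_ringEquiv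
    (R := blowupAlgebra (Ideal.span (Set.range (cen k))) (cen k i) ⧸ Ideal.span {blowupAlgebra.eval (cen k) i G})
    (blowupAlgebra.quotientKerMapQuotientEquiv _ _ hf (prime_algebraMap_cen k i) hndvd)

/-! ## The four strict-transform charts of the double line -/

/-- The chart equation `f₀ = y₀y₁² − y₂²` of `H` on `D₊(x₀)` (`y = (x₁, x₂, x₃)`). [folklore] -/
def f₀ : MvPolynomial (Fin 3) k := X 0 * X 1 ^ 2 - X 2 ^ 2

/-- The chart equation `f₁ = y₁² − y₀y₂²` of `H` on `D₊(x₁)` (`y = (x₀, x₂, x₃)`). [folklore] -/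
def f₁ : MvPolynomial (Fin 3) k := X 1 ^ 2 - X 0 * X 2 ^ 2

/-- The chart equation `f₂ = y₁ − y₀y₂²` of `H` on `D₊(x₂)` (`y = (x₀, x₁, x₃)`). [folklore] -/
def f₂ : MvPolynomial (Fin 3) k := X 1 - X 0 * X 2 ^ 2

/-- The chart equation `f₃ = y₁y₂² − y₀` of `H` on `D₊(x₃)` (`y = (x₀, x₁, x₂)`). [folklore] -/
def f₃ : MvPolynomial (Fin 3) k := X 1 * X 2 ^ 2 - X 0

/-- `b · (1/b) = 1` in `A[1/b]`. [folklore] -/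
theorem algebraMap_mul_invSelf (i : Fin 2) :
    algebraMap (MvPolynomial (Fin 3) k) (Localization.Away (cen k i)) (cen k i) * IsLocalization.Away.invSelf (cen k i) = 1 :=
  IsLocalization.Away.mul_invSelf (cen k i)

/-- **Chart `c = 0`, `b = y₁`**: `f₀ = y₁²·(y₀ − t²)`, `t = y₂/y₁`, `∂₀(y₀ − t²) = 1`; the chart ring
`(A/(f₀))[Ī/ȳ₁]` is regular. [folklore] -/
theorem isRegularRing_chart₀₁ :
    IsRegularRing (blowupAlgebra ((Ideal.span (Set.range (cen k))).map (Ideal.Quotient.mk (Ideal.span {f₀ k})))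
      (Ideal.Quotient.mk (Ideal.span {f₀ k}) (cen k 0))) := by
  refine isRegularRing_blowupAlgebra_quotient k 0 (n := 2) (C (X 0) - X ⟨1, one_ne_zero⟩ ^ 2) ?_ (m := 0) ?_ ?_
  · apply Subtype.ext
    rw [show f₀ k = X 0 * cen k 0 ^ 2 - cen k 1 ^ 2 from rfl]
    simp only [map_sub, map_mul, map_pow, blowupAlgebra.eval_C, blowupAlgebra.eval_X, Subalgebra.coe_mul,
      Subalgebra.coe_pow, Subalgebra.coe_sub, Subalgebra.coe_algebraMap, blowupAlgebra.coe_frac]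
    have h := algebraMap_mul_invSelf k 0
    linear_combination (algebraMap (MvPolynomial (Fin 3) k) (Localization.Away (cen k 0)) (cen k 1) ^ 2 * (algebraMap (MvPolynomial (Fin 3) k) (Localization.Away (cen k 0)) (cen k 0) * IsLocalization.Away.invSelf (cen k 0) + 1)) * h
  · simpa [MvPolynomial.coeff_C, MvPolynomial.coeff_X_pow] using X_zero_not_mem k
  · intro D hD hfrac
    have hval : D (blowupAlgebra.eval (cen k) 0 (C (X 0) - X ⟨1, one_ne_zero⟩ ^ 2)) = 1 := by
      simp only [map_sub, map_pow, blowupAlgebra.eval_C, blowupAlgebra.eval_X, Derivation.leibniz_pow, hfrac, hD,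
        smul_zero, sub_zero, pderiv_X_self, map_one]
    rw [hval, map_one]
    exact isUnit_one

/-- **Chart `c = 0`, `b = y₂`**: `f₀ = y₂²·(y₀s² − 1)`, `s = y₁/y₂`, `∂₀(y₀s² − 1) = s²`, a unit modulo `y₀s² − 1`; the chart
ring `(A/(f₀))[Ī/ȳ₂]` is regular. [folklore] -/
theorem isRegularRing_chart₀₂ :
    IsRegularRing (blowupAlgebra ((Ideal.span (Set.range (cen k))).map (Ideal.Quotient.mk (Ideal.span {f₀ k})))
      (Ideal.Quotient.mk (Ideal.span {f₀ k}) (cen k 1))) := by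
  refine isRegularRing_blowupAlgebra_quotient k 1 (n := 2) (C (X 0) * X ⟨0, zero_ne_one⟩ ^ 2 - 1) ?_ (m := 0) ?_ ?_
  · apply Subtype.ext
    rw [show f₀ k = X 0 * cen k 0 ^ 2 - cen k 1 ^ 2 from rfl]
    simp only [map_sub, map_mul, map_pow, map_one, blowupAlgebra.eval_C, blowupAlgebra.eval_X, Subalgebra.coe_mul,
      Subalgebra.coe_pow, Subalgebra.coe_sub, Subalgebra.coe_one, Subalgebra.coe_algebraMap, blowupAlgebra.coe_frac]
    have h := algebraMap_mul_invSelf k 1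
    linear_combination (-(algebraMap (MvPolynomial (Fin 3) k) (Localization.Away (cen k 1)) (X 0)) * algebraMap (MvPolynomial (Fin 3) k) (Localization.Away (cen k 1)) (cen k 0) ^ 2 * (algebraMap (MvPolynomial (Fin 3) k) (Localization.Away (cen k 1)) (cen k 1) * IsLocalization.Away.invSelf (cen k 1) + 1)) * h
  · simpa [MvPolynomial.coeff_C, MvPolynomial.coeff_X_pow] using fun h => one_not_mem k ((Ideal.neg_mem_iff _).mp h)
  · intro D hD hfrac
    set s := blowupAlgebra.frac (cen k) 1 0
    have hev : blowupAlgebra.eval (cen k) 1 (C (X 0) * X ⟨0, zero_ne_one⟩ ^ 2 - 1) = algebraMap (MvPolynomial (Fin 3) k) _ (X 0) * s ^ 2 - 1 := by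
      simp only [map_sub, map_mul, map_pow, map_one, blowupAlgebra.eval_C, blowupAlgebra.eval_X, s]
    have hDs : D s = 0 := hfrac 0
    have hval : D (blowupAlgebra.eval (cen k) 1 (C (X 0) * X ⟨0, zero_ne_one⟩ ^ 2 - 1)) = s ^ 2 := by
      rw [hev]
      simp only [map_sub, map_one, Derivation.leibniz, Derivation.leibniz_pow, hDs, hD, mul_zero, smul_zero,
        zero_add, sub_zero, pderiv_X_self, smul_eq_mul, mul_one, Derivation.map_one_eq_zero]
    rw [hval]
    refine isUnit_of_mul_eq_one' (Ideal.Quotient.mk _ (algebraMap (MvPolynomial (Fin 3) k) (blowupAlgebra (Ideal.span (Set.range (cen k))) (cen k 1)) (X 0))) ?_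
    rw [← map_mul, ← (Ideal.Quotient.mk _).map_one, Ideal.Quotient.eq, hev]
    exact Ideal.mem_span_singleton.mpr ⟨1, by ring⟩

/-- **Chart `c = 1`, `b = y₁`**: `f₁ = y₁²·(1 − y₀t²)`, `t = y₂/y₁`, `∂₀(1 − y₀t²) = −t²`, a unit modulo `1 − y₀t²`; the
chart ring `(A/(f₁))[Ī/ȳ₁]` is regular. [folklore] -/
theorem isRegularRing_chart₁₁ :
    IsRegularRing (blowupAlgebra ((Ideal.span (Set.range (cen k))).map (Ideal.Quotient.mk (Ideal.span {f₁ k})))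
      (Ideal.Quotient.mk (Ideal.span {f₁ k}) (cen k 0))) := by
  refine isRegularRing_blowupAlgebra_quotient k 0 (n := 2) (1 - C (X 0) * X ⟨1, one_ne_zero⟩ ^ 2) ?_ (m := 0) ?_ ?_
  · apply Subtype.ext
    rw [show f₁ k = cen k 0 ^ 2 - X 0 * cen k 1 ^ 2 from rfl]
    simp only [map_sub, map_mul, map_pow, map_one, blowupAlgebra.eval_C, blowupAlgebra.eval_X, Subalgebra.coe_mul,
      Subalgebra.coe_pow, Subalgebra.coe_sub, Subalgebra.coe_one, Subalgebra.coe_algebraMap, blowupAlgebra.coe_frac]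
    have h := algebraMap_mul_invSelf k 0
    linear_combination (algebraMap (MvPolynomial (Fin 3) k) (Localization.Away (cen k 0)) (X 0) * algebraMap (MvPolynomial (Fin 3) k) (Localization.Away (cen k 0)) (cen k 1) ^ 2 * (algebraMap (MvPolynomial (Fin 3) k) (Localization.Away (cen k 0)) (cen k 0) * IsLocalization.Away.invSelf (cen k 0) + 1)) * h
  · simpa [MvPolynomial.coeff_C, MvPolynomial.coeff_X_pow] using one_not_mem k
  · intro D hD hfrac
    set t := blowupAlgebra.frac (cen k) 0 1
    have hev : blowupAlgebra.eval (cen k) 0 (1 - C (X 0) * X ⟨1, one_ne_zero⟩ ^ 2) = 1 - algebraMap (MvPolynomial (Fin 3) k) _ (X 0) * t ^ 2 := by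
      simp only [map_sub, map_mul, map_pow, map_one, blowupAlgebra.eval_C, blowupAlgebra.eval_X, t]
    have hDt : D t = 0 := hfrac 1
    have hval : D (blowupAlgebra.eval (cen k) 0 (1 - C (X 0) * X ⟨1, one_ne_zero⟩ ^ 2)) = -t ^ 2 := by
      rw [hev]
      simp only [map_sub, map_one, Derivation.leibniz, Derivation.leibniz_pow, hDt, hD, mul_zero, smul_zero,
        zero_add, zero_sub, pderiv_X_self, smul_eq_mul, mul_one, Derivation.map_one_eq_zero]
    rw [hval]
    refine isUnit_of_mul_eq_one' (Ideal.Quotient.mk _ (-algebraMap (MvPolynomial (Fin 3) k) (blowupAlgebra (Ideal.span (Set.range (cen k))) (cen k 0)) (X 0))) ?_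
    rw [← map_mul, ← (Ideal.Quotient.mk _).map_one, Ideal.Quotient.eq, hev]
    exact Ideal.mem_span_singleton.mpr ⟨-1, by ring⟩

/-- **Chart `c = 1`, `b = y₂`**: `f₁ = y₂²·(s² − y₀)`, `s = y₁/y₂`, `∂₀(s² − y₀) = −1`; the chart ring `(A/(f₁))[Ī/ȳ₂]` is
regular. [folklore] -/
theorem isRegularRing_chart₁₂ :
    IsRegularRing (blowupAlgebra ((Ideal.span (Set.range (cen k))).map (Ideal.Quotient.mk (Ideal.span {f₁ k})))
      (Ideal.Quotient.mk (Ideal.span {f₁ k}) (cen k 1))) := by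
  refine isRegularRing_blowupAlgebra_quotient k 1 (n := 2) (X ⟨0, zero_ne_one⟩ ^ 2 - C (X 0)) ?_ (m := 0) ?_ ?_
  · apply Subtype.ext
    rw [show f₁ k = cen k 0 ^ 2 - X 0 * cen k 1 ^ 2 from rfl]
    simp only [map_sub, map_mul, map_pow, blowupAlgebra.eval_C, blowupAlgebra.eval_X, Subalgebra.coe_mul,
      Subalgebra.coe_pow, Subalgebra.coe_sub, Subalgebra.coe_algebraMap, blowupAlgebra.coe_frac]
    have h := algebraMap_mul_invSelf k 1
    linear_combination (-(algebraMap (MvPolynomial (Fin 3) k) (Localization.Away (cen k 1)) (cen k 0)) ^ 2 * (algebraMap (MvPolynomial (Fin 3) k) (Localization.Away (cen k 1)) (cen k 1) * IsLocalization.Away.invSelf (cen k 1) + 1)) * h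
  · simpa [MvPolynomial.coeff_C, MvPolynomial.coeff_X_pow] using fun h => X_zero_not_mem k ((Ideal.neg_mem_iff _).mp h)
  · intro D hD hfrac
    have hval : D (blowupAlgebra.eval (cen k) 1 (X ⟨0, zero_ne_one⟩ ^ 2 - C (X 0))) = -1 := by
      simp only [map_sub, map_pow, blowupAlgebra.eval_C, blowupAlgebra.eval_X, Derivation.leibniz_pow, hfrac, hD,
        smul_zero, zero_sub, pderiv_X_self, map_one]
    rw [hval]
    exact ((isUnit_one (M := ↥(blowupAlgebra (Ideal.span (Set.range (cen k))) (cen k 1)))).neg).map (Ideal.Quotient.mk _)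

/-! ## The two charts off the double line -/

/-- **Chart `c = 2`**: `A/(f₂)`, `f₂ = y₁ − y₀y₂²`, is a regular ring (`∂₁ f₂ = 1`). [folklore] -/
theorem isRegularRing_quotient_f₂ : IsRegularRing (MvPolynomial (Fin 3) k ⧸ Ideal.span {f₂ k}) := by
  refine isRegularRing_quotient_of_derivation (f₂ k)
    (pderiv 1 : Derivation k (MvPolynomial (Fin 3) k) (MvPolynomial (Fin 3) k)) ?_
  have h : (pderiv 1 : Derivation k (MvPolynomial (Fin 3) k) (MvPolynomial (Fin 3) k)) (f₂ k) = 1 := by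
    simp [f₂, pderiv_X, Derivation.leibniz_pow]
  rw [h, map_one]
  exact isUnit_one

/-- **Chart `c = 3`**: `A/(f₃)`, `f₃ = y₁y₂² − y₀`, is a regular ring (`∂₀ f₃ = −1`). [folklore] -/
theorem isRegularRing_quotient_f₃ : IsRegularRing (MvPolynomial (Fin 3) k ⧸ Ideal.span {f₃ k}) := by
  refine isRegularRing_quotient_of_derivation (f₃ k)
    (pderiv 0 : Derivation k (MvPolynomial (Fin 3) k) (MvPolynomial (Fin 3) k)) ?_
  have h : (pderiv 0 : Derivation k (MvPolynomial (Fin 3) k) (MvPolynomial (Fin 3) k)) (f₃ k) = -1 := by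
    simp [f₃, pderiv_X, Derivation.leibniz_pow]
  rw [h]
  exact ((isUnit_one (M := MvPolynomial (Fin 3) k)).neg).map (Ideal.Quotient.mk _)

/-- `A/(f₂)` is reduced (a regular ring is reduced), so `(f₂)` is a radical ideal. [folklore] -/
theorem radical_span_f₂ : (Ideal.span {f₂ k}).radical = Ideal.span {f₂ k} := by
  haveI := isRegularRing_quotient_f₂ k
  haveI := IsRegularRing.isReduced' (MvPolynomial (Fin 3) k ⧸ Ideal.span {f₂ k})
  exact (Ideal.isRadical_iff_quotient_reduced _).mpr inferInstance |>.radical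

/-- `A/(f₃)` is reduced, so `(f₃)` is a radical ideal. [folklore] -/
theorem radical_span_f₃ : (Ideal.span {f₃ k}).radical = Ideal.span {f₃ k} := by
  haveI := isRegularRing_quotient_f₃ k
  haveI := IsRegularRing.isReduced' (MvPolynomial (Fin 3) k ⧸ Ideal.span {f₃ k})
  exact (Ideal.isRadical_iff_quotient_reduced _).mpr inferInstance |>.radical

end WhitneyCubic

end Summit.ResolutionOfSingularities.ResolutionOfSingularities.Cruxes.EquisingularLiftNat.Sections

end
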